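import Mathlib

/-!
# STUB-IDEAS `stub_heegnerIndexLowerAtTwo` — ideator k = 3, gen 46 — technique: DECOMPOSITION
# (split into sub-stubs with a PROVABLE glue).  Typed sketch; `import Mathlib` only; no `sorry`, no axioms.

BSD is NOT proved by any of this.  Nothing here touches the registered skeleton
(`heegner_index_two_lower.lean`, sha `f2bd84c029a8a938`) or restates the stub / the crux
`SplitBadTwoLowerHalfOfFacts`; the LOWER half `ord₂ #Ш_an ≤ ord₂ #Ш` for the class
`K₀ = ℚ(√-7)`, `d ≢ 1 (mod 4)` stays OPEN.

## What is typed here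

§1  THE CUT GLUE (proved).  Abstract Weierstrass currency: `A` a local domain whose maximal ideal is
    principal `𝔪 = (ϖ)` (dictionary: `A = W(𝔽̄₂) = 𝓞_{ℚ₂^{ur}}^∧`, `ϖ = 2`; `F = char_Λ X^{∅,0}(A′/K_∞^{ac})`,
    `L = L₂^{BDP}(f_{A′}/K)`), `μ(G) = 0` ≘ `red G ≠ 0`, `λ(G)` ≘ `(red G).order`.
    * `dvd_of_dvd_C_pow_mul`      — ERROR-TERM ABSORPTION: `μ(F) = 0 ∧ F ∣ ϖ^t·L ⟹ F ∣ L`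
                                    (the `2^t` of a Howard/CGLS "Kolyvagin system with error" is killed by the
                                    ALGEBRAIC `μ = 0` alone — no analytic input);
    * `associated_of_dvd_of_lam_le` — MATCH UPGRADE: `F ∣ L ∧ μ(L) = 0 ∧ λ(L) ≤ λ(F) ⟹ F ~ L`
                                    (only the analytic INEQUALITY `λ(L) ≤ λ(F)` is needed, not the full match);
    * `span_eq_of_cut`, `lower_of_cut` — the glue of the decomposition
      `S1 (UPPER with error) → S3a (μ_alg = 0) → S2a (μ_an = 0) → S4≤ (λ_an ≤ λ_alg) → LOWER ((F) ⊆ (L), i.e. L ∣ F)`.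
§2  `analyticIneq_of_pieces` — the bookkeeping by which S2/S3/S4 produce `λ(L) ≤ λ(F)` from the residual
    (two trivial characters at `2`) pieces: CGLS Thm. 3.3.5-shape `λ(F) = λ_φ + λ_ψ + c`, Kriz-shape
    `λ(L) = λ′_φ + λ′_ψ + c′`, residual main conjectures `λ′_• ≤ λ_•`, correction match `c′ ≤ c`.
§3  N1 (a decided digit for S1's wall): complex conjugation `τ` on the period lattice.  For `Δ(A′) < 0`
    (here `Δ(49a1^{(d*)}) = d*⁶·Δ(49a1) < 0`) the lattice is `ℤ + ℤ(½ + it/2)` [Silverman ATAEC V (2.3), Ex. 5.6(b)],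
    `τ = [[1,1],[0,-1]]`, and `T/(τ-1)T` is FREE OF RANK ONE (`coker_tauMinus_torsionFree`,
    `coker_tauMinus_rankOne`) — Mazur–Rubin's integral `τ`-hypothesis survives at `2`; for `Δ > 0`
    (`τ = diag(1,-1)`) it FAILS (`coker_tauPlus_has_twoTorsion`).  Howard's residual form of H2
    ("`τ` splits `T/𝔪T` into two eigenlines") fails at `2` either way (`τ ≡ unipotent ≠ 1` resp. `τ ≡ 1`).
-/

set_option linter.dupNamespace false

namespace Summit.BirchSwinnertonDyer.BirchSwinnertonDyer.Cruxes.SplitBadTwoLowerHalfOfFacts.ImcCutK3G46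

open PowerSeries IsLocalRing

/-! ## §1 The cut glue in the abstract Weierstrass currency -/

section Glue

variable {A : Type*} [CommRing A] [IsDomain A] [IsLocalRing A]

/-- Reduction of a power series modulo the maximal ideal. -/
noncomputable def red (F : A⟦X⟧) : (ResidueField A)⟦X⟧ := PowerSeries.map (residue A) F

omit [IsDomain A] in
theorem coeff_red (F : A⟦X⟧) (n : ℕ) : coeff n (red F) = residue A (coeff n F) := by
  simp [red, coeff_map]

/-- `μ(F) = 0`: some coefficient of `F` is a unit. -/
def MuZero (F : A⟦X⟧) : Prop := red F ≠ 0

/-- `λ(F)`: the order of vanishing of the reduction (= the Weierstrass degree when `μ(F) = 0`; `⊤` iff `μ(F) > 0`). -/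
noncomputable def lam (F : A⟦X⟧) : ℕ∞ := (red F).order

omit [IsDomain A] in
theorem red_eq_zero_iff (F : A⟦X⟧) : red F = 0 ↔ ∀ n, coeff n F ∈ maximalIdeal A := by
  constructor
  · intro h n
    have := congrArg (coeff n) h
    rw [coeff_red, map_zero, residue_eq_zero_iff] at this
    exact this
  · intro h
    ext n
    rw [coeff_red, map_zero, residue_eq_zero_iff]
    exact h n

omit [IsDomain A] in
theorem red_mul (F G : A⟦X⟧) : red (F * G) = red F * red G := by
  simp [red]

omit [IsDomain A] in
theorem red_pow (F : A⟦X⟧) (t : ℕ) : red (F ^ t) = red F ^ t := by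
  simp [red]

omit [IsDomain A] [IsLocalRing A] in
/-- If every coefficient of `h` is a multiple of `ϖ`, then `C ϖ ∣ h`. -/
theorem C_dvd_of_forall_coeff_mem {ϖ : A} {h : A⟦X⟧} (hh : ∀ n, coeff n h ∈ Ideal.span {ϖ}) :
    C ϖ ∣ h := by
  choose g hg using fun n => Ideal.mem_span_singleton'.mp (hh n)
  refine ⟨PowerSeries.mk g, ?_⟩
  ext n
  simp only [coeff_C_mul, coeff_mk]
  rw [← hg n, mul_comm]

omit [IsDomain A] in
/-- If `μ(F) = 0`, `𝔪 = (ϖ)` and `F * h` reduces to `0`, then `C ϖ ∣ h`. -/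
theorem C_dvd_of_red_mul_eq_zero {ϖ : A} (hϖ : maximalIdeal A = Ideal.span {ϖ}) {F h : A⟦X⟧}
    (hF : MuZero F) (h0 : red (F * h) = 0) : C ϖ ∣ h := by
  rw [red_mul] at h0
  have hh : red h = 0 := (mul_eq_zero.mp h0).resolve_left hF
  apply C_dvd_of_forall_coeff_mem
  intro n
  rw [← hϖ]
  exact (red_eq_zero_iff h).mp hh n

omit [IsDomain A] in
theorem red_C_of_mem {ϖ : A} (hϖ : ϖ ∈ maximalIdeal A) : red (C ϖ : A⟦X⟧) = 0 := by
  simp [red, map_C, (residue_eq_zero_iff ϖ).mpr hϖ]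

/-- **ERROR-TERM ABSORPTION.** In the Weierstrass currency, an UPPER inclusion with error `F ∣ ϖ^t·L`
(Howard / CGLS "Kolyvagin system argument with error term") plus the ALGEBRAIC `μ(F) = 0` already gives `F ∣ L`:
no analytic input is used.  (`ϖ ≠ 0` is necessary: over a field `X ∣ 0·1` but `X ∤ 1`.)
[shape: Castella–Grossi–Lee–Skinner, Invent. Math. 227 (2022) §4.2 + proof of Thm. 5.3.1; Howard, Duke Math. J. 124 (2004) §2] -/
theorem dvd_of_dvd_C_pow_mul {ϖ : A} (hϖ : maximalIdeal A = Ideal.span {ϖ}) (hϖ0 : ϖ ≠ 0) {F L : A⟦X⟧}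
    (hF : MuZero F) : ∀ t : ℕ, F ∣ C ϖ ^ t * L → F ∣ L := by
  have hϖm : ϖ ∈ maximalIdeal A := by rw [hϖ]; exact Ideal.mem_span_singleton_self ϖ
  have hC : (C ϖ : A⟦X⟧) ≠ 0 := fun e => hϖ0 (by simpa using congrArg constantCoeff e)
  intro t
  induction t with
  | zero => simp
  | succ t ih =>
    rintro ⟨h, hh⟩
    have h0 : red (F * h) = 0 := by
      rw [← hh, red_mul, red_pow, red_C_of_mem hϖm, zero_pow (Nat.succ_ne_zero t), zero_mul]
    obtain ⟨h', rfl⟩ := C_dvd_of_red_mul_eq_zero hϖ hF h0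
    apply ih
    refine ⟨h', mul_left_cancel₀ hC ?_⟩
    calc C ϖ * (C ϖ ^ t * L) = C ϖ ^ (t + 1) * L := by ring
      _ = F * (C ϖ * h') := hh
      _ = C ϖ * (F * h') := by ring

omit [IsDomain A] in
/-- **MATCH UPGRADE.** `F ∣ L`, `μ(L) = 0` and the INEQUALITY `λ(L) ≤ λ(F)` force `F ~ L`: the cofactor reduces to a
power series of order `0`, i.e. has unit constant term.  (Only `λ_an ≤ λ_alg` is needed, not the full Greenberg–Vatsal match;
compare the tree's norm-currency `span_le_of_le_span_of_match` in `PrintCFramBottomClassIndexLawFiveLeEisensteinEndStatePointwise`.)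
[shape: Greenberg–Vatsal, Invent. Math. 142 (2000) Thm. (1.3); CGLS 2022 display (5.4)] -/
theorem associated_of_dvd_of_lam_le {F L : A⟦X⟧} (hdiv : F ∣ L) (hL : MuZero L) (hle : lam L ≤ lam F) :
    Associated F L := by
  obtain ⟨h, rfl⟩ := hdiv
  have hF : MuZero F := by
    intro hF0; apply hL; rw [red_mul, hF0, zero_mul]
  have hh : red h ≠ 0 := by
    intro hh0; apply hL; rw [red_mul, hh0, mul_zero]
  -- orders are finite
  obtain ⟨n, hn⟩ := ENat.ne_top_iff_exists.mp (mt order_eq_top.mp hF)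
  obtain ⟨m, hm⟩ := ENat.ne_top_iff_exists.mp (mt order_eq_top.mp hh)
  have hsum : lam (F * h) = lam F + (red h).order := by
    unfold lam; rw [red_mul, order_mul]
  have hm0 : m = 0 := by
    unfold lam at hle hsum
    rw [hsum, ← hn, ← hm] at hle
    have : (n : ℕ∞) + m ≤ n := hle
    have := (ENat.coe_add n m).symm ▸ this
    norm_cast at this
    omega
  -- so the constant coefficient of `h` is a unit
  have hunit : IsUnit (constantCoeff h) := by
    have h0 : coeff 0 (red h) ≠ 0 := by
      have := (order_eq_nat.mp (by rw [← hm, hm0]; rfl : (red h).order = 0)).1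
      exact this
    rw [coeff_red, coeff_zero_eq_constantCoeff] at h0
    by_contra hnu
    exact h0 ((residue_eq_zero_iff _).mpr ((mem_maximalIdeal _).mpr hnu))
  exact associated_mul_unit_right F h (isUnit_iff_constantCoeff.mpr hunit)

/-- **THE CUT GLUE.**  UPPER-with-error (S1) + `μ_alg = 0` (S3a) + `μ_an = 0` (S2a) + `λ_an ≤ λ_alg` (S4≤) ⟹ EQUALITY of the
principal ideals — hence in particular the LOWER inclusion. -/
theorem span_eq_of_cut {ϖ : A} (hϖ : maximalIdeal A = Ideal.span {ϖ}) (hϖ0 : ϖ ≠ 0) {F L : A⟦X⟧} (t : ℕ)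
    (hU : F ∣ C ϖ ^ t * L) (hμF : MuZero F) (hμL : MuZero L) (hlam : lam L ≤ lam F) :
    Ideal.span {F} = Ideal.span {L} :=
  Ideal.span_singleton_eq_span_singleton.mpr
    (associated_of_dvd_of_lam_le (dvd_of_dvd_C_pow_mul hϖ hϖ0 hμF t hU) hμL hlam)

/-- **LOWER from the cut**: `(F) ⊆ (L)`, i.e. `L ∣ F` — the direction `stub_heegnerIndexLowerAtTwo` needs (road δ's
`stub_lowerDivisibility_two` shape `charIdeal ≤ span {L}`), now for the good-ordinary `2`-Eisenstein TWIN `A′`. -/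
theorem lower_of_cut {ϖ : A} (hϖ : maximalIdeal A = Ideal.span {ϖ}) (hϖ0 : ϖ ≠ 0) {F L : A⟦X⟧} (t : ℕ)
    (hU : F ∣ C ϖ ^ t * L) (hμF : MuZero F) (hμL : MuZero L) (hlam : lam L ≤ lam F) :
    Ideal.span {F} ≤ Ideal.span {L} :=
  (span_eq_of_cut hϖ hϖ0 t hU hμF hμL hlam).le

omit [IsDomain A] in
/-- Sanity (the cut loses nothing): conversely EQUALITY of the ideals gives back every piece's conclusion trivially
(`λ`/`μ` agree for associates). -/
theorem lam_eq_of_associated {F L : A⟦X⟧} (h : Associated F L) : lam F = lam L ∧ (MuZero F ↔ MuZero L) := by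
  obtain ⟨u, rfl⟩ := h
  have hu : IsUnit (red (u : A⟦X⟧)) := (PowerSeries.map (residue A)).isUnit_map u.isUnit
  have hu0 : (red (u : A⟦X⟧)).order = 0 := by
    have hc : IsUnit (constantCoeff (red (u : A⟦X⟧))) := isUnit_iff_constantCoeff.mp hu
    exact order_eq_nat.mpr ⟨by rw [coeff_zero_eq_constantCoeff]; exact hc.ne_zero, fun i hi => (Nat.not_lt_zero i hi).elim⟩
  refine ⟨?_, ?_⟩
  · unfold lam; rw [red_mul, order_mul, hu0, add_zero]
  · unfold MuZero; rw [red_mul, ne_eq, ne_eq, hu.mul_left_eq_zero]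

end Glue

/-! ## §2 Bookkeeping of the residual pieces (how S2, S3, S4 yield `λ_an ≤ λ_alg`) -/

/-- CGLS Thm. 3.3.5-shape (algebraic): `λ(F) = λ(X_φ) + λ(X_ψ) + c`; Kriz / CGLS Thm. 4.1.2-shape (analytic):
`λ(L) = λ(L_φ) + λ(L_ψ) + c′`; residual (two trivial characters at `2` over the Heegner field `K`) main-conjecture
INEQUALITIES `λ(L_•) ≤ λ(X_•)` (the divisibility direction supplied by an Euler system of elliptic units / by Müller 2020
over `K`) and a correction comparison `c′ ≤ c` add up to the analytic inequality `S4≤`.  Pure arithmetic — recorded so that the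
line card can point at which summand each wall sits on. -/
theorem analyticIneq_of_pieces {lamF lamL lamXφ lamXψ lamLφ lamLψ c c' : ℕ}
    (halg : lamF = lamXφ + lamXψ + c) (han : lamL = lamLφ + lamLψ + c')
    (hφ : lamLφ ≤ lamXφ) (hψ : lamLψ ≤ lamXψ) (hc : c' ≤ c) : lamL ≤ lamF := by
  omega

/-- … and with `F ∣ L` (from S1 + S3a, §1) the inequality is automatically an equality: `λ(F) ≤ λ(L)` always holds for a
divisor, so every residual inequality above was in fact sharp.  (`ℕ∞`-version of "a divisor has smaller order".) -/
theorem lam_le_of_dvd {A : Type*} [CommRing A] [IsLocalRing A] {F L : A⟦X⟧} (h : F ∣ L) :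
    lam F ≤ lam L := by
  obtain ⟨g, rfl⟩ := h
  unfold lam; rw [red_mul, order_mul]; exact le_self_add

/-! ## §3 N1 — complex conjugation on the period lattice at `2` (wall placement for S1)

`τ₋` = conjugation on `ℤ·1 ⊕ ℤ·ω`, `ω = ½ + it/2` (`Δ < 0`): `1 ↦ 1`, `ω ↦ 1 - ω`, i.e. `(x, y) ↦ (x + y, -y)`;
`τ₊` = conjugation on `ℤ·1 ⊕ ℤ·it` (`Δ > 0`): `(x, y) ↦ (x, -y)`. -/

/-- `τ₋ - 1 : (x, y) ↦ (y, -2y)`. -/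
def tauMinusSubOne (v : ℤ × ℤ) : ℤ × ℤ := (v.2, -2 * v.2)

/-- `τ₊ - 1 : (x, y) ↦ (0, -2y)`. -/
def tauPlusSubOne (v : ℤ × ℤ) : ℤ × ℤ := (0, -2 * v.2)

/-- `Δ < 0`: the cokernel of `τ - 1` on the lattice is TORSION-FREE … -/
theorem coker_tauMinus_torsionFree (v : ℤ × ℤ) (n : ℤ) (hn : n ≠ 0)
    (h : ∃ w, n • v = tauMinusSubOne w) : ∃ w, v = tauMinusSubOne w := by
  obtain ⟨⟨a, b⟩, hw⟩ := h
  obtain ⟨x, y⟩ := v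
  simp only [tauMinusSubOne, Prod.smul_mk, smul_eq_mul, Prod.mk.injEq] at hw ⊢
  obtain ⟨h1, h2⟩ := hw
  have key : n * (y + 2 * x) = 0 := by linear_combination h2 + 2 * h1
  have hy : y + 2 * x = 0 := (mul_eq_zero.mp key).resolve_left hn
  exact ⟨(0, x), rfl, by omega⟩

/-- … and of RANK ONE: `(x, y) ↦ 2x + y` identifies `ℤ² / (τ₋ - 1)ℤ²` with `ℤ`
(surjective, kernel = image of `τ₋ - 1`).  So `T₂A′/(τ - 1)T₂A′` is free of rank one for `Δ(A′) < 0`. -/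
theorem coker_tauMinus_rankOne :
    Function.Surjective (fun v : ℤ × ℤ => 2 * v.1 + v.2) ∧
      ∀ v : ℤ × ℤ, 2 * v.1 + v.2 = 0 ↔ ∃ w, v = tauMinusSubOne w := by
  refine ⟨fun z => ⟨(0, z), by simp⟩, ?_⟩
  rintro ⟨x, y⟩
  constructor
  · intro h
    exact ⟨(0, x), Prod.ext rfl (show y = -2 * x by omega)⟩
  · rintro ⟨⟨a, b⟩, hw⟩
    simp only [tauMinusSubOne, Prod.mk.injEq] at hw
    omega

/-- `Δ > 0`: the cokernel of `τ - 1` has `2`-TORSION (`(0,1)` is not in the image but `2·(0,1)` is), so the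
integral `τ`-hypothesis FAILS — the twin `A′ = 49a1^{(d*)}` is on the good side because `Δ(49a1) = -7³ < 0`. -/
theorem coker_tauPlus_has_twoTorsion :
    ∃ v : ℤ × ℤ, (∃ w, (2 : ℤ) • v = tauPlusSubOne w) ∧ ¬ ∃ w, v = tauPlusSubOne w := by
  refine ⟨(0, 1), ⟨(0, -1), by simp [tauPlusSubOne]⟩, ?_⟩
  rintro ⟨⟨a, b⟩, hw⟩
  simp only [tauPlusSubOne, Prod.mk.injEq] at hw
  omega

/-- Residual form (Howard 2004 hypothesis H2, second clause: "`τ` splits `T/𝔪T` into two one-dimensional eigenspaces")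
FAILS at `2` for `Δ < 0`: `τ₋ mod 2 = [[1,1],[0,1]]` is a non-trivial unipotent, its fixed space in `𝔽₂²` is a single line. -/
theorem tauMinus_mod_two_not_diagonalisable :
    ¬ ∀ v : ZMod 2 × ZMod 2, (v.1 + v.2, -v.2) = v := by
  intro h
  have := h (0, 1)
  simp at this


end Summit.BirchSwinnertonDyer.BirchSwinnertonDyer.Cruxes.SplitBadTwoLowerHalfOfFacts.ImcCutK3G46
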